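import Summits.AtomisticToContinuum.HydrodynamicLimit.Theses.RelayRaceLocality
import Summits.AtomisticToContinuum.HydrodynamicLimit.Theorems.RestartPrinciple.Negative.ConsequentImpAntecedent
import Summits.AtomisticToContinuum.HydrodynamicLimit.Theorems.RestartPrinciple.Negative.RestartSchema
import Summits.AtomisticToContinuum.HydrodynamicLimit.Theorems.RestartPrinciple.Negative.StubRestartableHLOfGuardedConjunct
import Summits.AtomisticToContinuum.HydrodynamicLimit.Theorems.RelayRaceLocalityRestartPrincipleReduction
import Summits.AtomisticToContinuum.HydrodynamicLimit.Theorems.RelayRaceLocalityRestartPrincipleOfConjunct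
import HarnessLib

/-!
# STRATEGY CENSUS certificate — crux `RestartPrinciple` (stmt-AtomisticToContinuum-12503)

Crux-strategist (wall-breaker) evidence file, 2026-08-17. Nothing here is proposed to the tree; every
non-trivial proof term is a NAME already landed under `Theorems/`. It kernel-checks the four census
headings of `STRATEGY-CENSUS.md`:

* §1 anatomy: `RestartPrinciple = (S → _root_.HydrodynamicLimit)` (`Iff.rfl`) and
  `_root_.HydrodynamicLimit → S` (p101123), so `RP ↔ (S ↔ conjunct)`;
* §2 LEVERAGE RIGIDITY (line-independent; subsumes the per-line certificates of leads c3/c8/c12):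
  for ANY proposition `L` with `L → RestartPrinciple`, `S → L → conjunct`; if moreover the conjunct
  implies `L` (every "physically true" residue weaker than the summit), then `S → (L ↔ conjunct)`.
  Since `S` is this route's own deliverable (ConeLocalisation 12504 ∘ 12500 ∘ 12502), inside the route
  every admissible residue of every line is the conjunct: the wall has no line-level door;
* §3 STRENGTHEN: the restartable-currency strengthening `RHL` (uniform prefix, restart from any
  `s₀`) is `↔ conjunct` (p108006 / p103746);
* §4 DECOMPOSITION: the only typed split that consumes `S`, `Upgrade := S → RHL` followed by the landed
  restart induction, has `Upgrade ↔ RestartPrinciple` — the open piece is the crux again; and the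
  abstract TIME-LAYER split (first layer from an `S`-shaped hypothesis, late layer restartable from
  strictly positive times with the conjunct's prefix) is schema-valid (`timeLayer_schema`), which
  isolates exactly what `S` can pay for: the initial layer `[0, τ₁(M₀))`, nothing else.
-/

noncomputable section

open Literature.MathematicalPhysics.KineticTheory Literature.Analysis.FluidPDE
open Literature.Analysis.FunctionSpaces MeasureTheory Filter Set Topology
open Summit.AtomisticToContinuum.HydrodynamicLimit.Theses.RelayRaceLocality
open Summit.AtomisticToContinuum.HydrodynamicLimit

namespace Summit.AtomisticToContinuum.HydrodynamicLimit.Cruxes.RestartPrinciple.StrategyCensus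

/-! ## §1 Anatomy -/

/-- `S`: the antecedent of the crux (short-time guarded HL from local-Gibbs time-0 data), verbatim. -/
def S : Prop :=
  ∃ η₀ : ℝ, 0 < η₀ ∧ ∀ M : ℝ, 0 < M → ∃ τ₁ : ℝ, 0 < τ₁ ∧ ∀ (a₀ θ₀ : T3 → ℝ) (u₀ : T3 → V3), Continuous a₀ → Continuous θ₀ → Continuous u₀ → (∀ x, 0 < a₀ x) → (∀ x, 0 < θ₀ x) → ∃ σ₀ : ℝ, 0 < σ₀ ∧ ∀ σ : ℝ, 0 < σ → σ < σ₀ → ∀ (T : ℝ) (ρ θ : ℝ → T3 → ℝ) (u : ℝ → T3 → V3), IsHardSphereEulerSolution σ T ρ u θ → ∀ Φ : (N : ℕ) → HardSphereFlow (Torus.geometry (Fin 3)) (hsDiameter σ N) (N + 1), TendstoHydroFieldsAt (fun N => localGibbsLaw σ a₀ u₀ θ₀ N (Φ N)) Φ ρ u θ 0 → ∀ t ∈ Set.Ico 0 (min T τ₁), (∀ s ∈ Set.Icc 0 t, ∀ x, ρ s x * σ ^ 3 < η₀ ∧ ρ s x ≤ M ∧ θ s x ≤ M ∧ M⁻¹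 ≤ θ s x ∧ ‖u s x‖ ≤ M ∧ ∀ i j k : Fin 3, |Torus.partialDeriv i (ρ s) x| ≤ M ∧ ‖Torus.partialDeriv i (u s) x‖ ≤ M ∧ |Torus.partialDeriv i (θ s) x| ≤ M ∧ |Torus.partialDeriv i (Torus.partialDeriv j (ρ s)) x| ≤ M ∧ ‖Torus.partialDeriv i (Torus.partialDeriv j (u s)) x‖ ≤ M ∧ |Torus.partialDeriv i (Torus.partialDeriv j (θ s)) x| ≤ M ∧ |Torus.partialDeriv i (Torus.partialDeriv j (Torus.partialDeriv k (ρ s))) x| ≤ M ∧ ‖Torus.partialDeriv i (Torus.partialDeriv j (Torus.partialDeriv k (u s))) x‖ ≤ M ∧ |Torus.partialDeriv i (Torus.partialDeriv j (Torus.partialDeriv k (θ s))) x| ≤ M) → TendstoHydroFieldsAt (fun N => localGibbsLaw σ a₀ u₀ θ₀ N (Φ N)) Φ ρ u θ t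

/-- The crux is literally `S → conjunct` (the consequent is the sub-problem decl verbatim). -/
theorem rp_iff : RestartPrinciple ↔ (S → _root_.HydrodynamicLimit) := Iff.rfl

/-- `conjunct → S` (disprover, p101123). -/
theorem conjunct_imp_S : _root_.HydrodynamicLimit → S :=
  fun h => Theorems.RestartPrincipleNegative.guardedConjunct_imp_shortTimeGuardedHL h

/-- Hence the crux is the equivalence of its halves. -/
theorem rp_iff_iff : RestartPrinciple ↔ (S ↔ _root_.HydrodynamicLimit) :=
  ⟨fun h => ⟨h, conjunct_imp_S⟩, fun h => h.1⟩

/-- `conjunct → RestartPrinciple` in one line (p132793): the crux closes the day the conjunct does. -/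
theorem rp_of_conjunct : _root_.HydrodynamicLimit → RestartPrinciple :=
  Theorems.RestartPrinciple.restartPrinciple_of_hydrodynamicLimit

/-! ## §2 Leverage rigidity (NEGATION / all headings: no line-level door) -/

/-- **Every sufficient residue dominates the conjunct, given `S`.** For ANY proposition `L` (the stub
conjunction of any conceivable line), if `L` closes the crux then under the route's own deliverable `S`
it proves the summit conjunct outright. -/
theorem residue_dominates (L : Prop) (hL : L → RestartPrinciple) : S → L → _root_.HydrodynamicLimit :=
  fun hS hl => hL hl hS

/-- **Leverage rigidity.** If moreover the conjunct implies `L` (i.e. `L` is not STRONGER than the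
summit), then given `S` the residue IS the conjunct. Dichotomy for every line on this crux: its residue
is either `≥` the summit strictly (not implied by it: rates, Rényi, flux bounds …) or, given `S`,
equivalent to it. -/
theorem leverage_rigidity (L : Prop) (hL : L → RestartPrinciple) (hGL : _root_.HydrodynamicLimit → L) :
    S → (L ↔ _root_.HydrodynamicLimit) :=
  fun hS => ⟨fun hl => hL hl hS, hGL⟩

/-- Unconditional form: a residue implied by the conjunct closes the crux iff the crux holds — it can
never be a proper reduction. -/
theorem residue_iff_rp (L : Prop) (hL : L → RestartPrinciple) (hGL : _root_.HydrodynamicLimit → L) :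
    (S → L) ↔ RestartPrinciple :=
  ⟨fun h hS => hL (h hS) hS, fun h hS => hGL (h hS)⟩

/-- NEGATION heading: a counterexample to the crux is exactly `S ∧ ¬ conjunct` (landed p101123,
re-derived): it must PROVE the short-time limit and REFUTE the summit conjunct. -/
theorem not_rp_iff : ¬ RestartPrinciple ↔ (S ∧ ¬ _root_.HydrodynamicLimit) := by
  rw [rp_iff]; exact Classical.not_imp

/-! ## §3 Strengthen: the restartable currency `RHL` is `↔ conjunct` -/

/-- `RHL`: the short-time limit in RESTARTABLE currency along the true law (prefix `∃ η₀ ∀ profile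
∃ σ₀ ∀ σ < σ₀ ∀ M ∃ τ₁`, restart from any `s₀ ∈ [0,T)` given the LLN on `[0, s₀]`), verbatim the
hypothesis of the landed restart induction (p108006) = line `Sketch`'s `stub_restartableHL`. -/
def RHL : Prop :=
  ∃ η₀ : ℝ, 0 < η₀ ∧ ∀ (a₀ θ₀ : T3 → ℝ) (u₀ : T3 → V3), Continuous a₀ → Continuous θ₀ →
      Continuous u₀ → (∀ x, 0 < a₀ x) → (∀ x, 0 < θ₀ x) → ∃ σ₀ : ℝ, 0 < σ₀ ∧ ∀ σ : ℝ, 0 < σ →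
      σ < σ₀ → ∀ M : ℝ, 0 < M → ∃ τ₁ : ℝ, 0 < τ₁ ∧ ∀ (T : ℝ) (ρ θ : ℝ → T3 → ℝ) (u : ℝ → T3 → V3),
      IsHardSphereEulerSolution σ T ρ u θ →
      ∀ Φ : (N : ℕ) → HardSphereFlow (Torus.geometry (Fin 3)) (hsDiameter σ N) (N + 1),
      ∀ s₀ ∈ Set.Ico 0 T,
      (∀ s ∈ Set.Icc 0 s₀,
        TendstoHydroFieldsAt (fun N => localGibbsLaw σ a₀ u₀ θ₀ N (Φ N)) Φ ρ u θ s) →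
      ∀ t ∈ Set.Ico s₀ (min T (s₀ + τ₁)),
      (∀ s ∈ Set.Icc 0 t, ∀ x, ρ s x * σ ^ 3 < η₀ ∧ ρ s x ≤ M ∧ θ s x ≤ M ∧ M⁻¹ ≤ θ s x ∧
        ‖u s x‖ ≤ M ∧ ∀ i j k : Fin 3, |Torus.partialDeriv i (ρ s) x| ≤ M ∧
        ‖Torus.partialDeriv i (u s) x‖ ≤ M ∧ |Torus.partialDeriv i (θ s) x| ≤ M ∧
        |Torus.partialDeriv i (Torus.partialDeriv j (ρ s)) x| ≤ M ∧
        ‖Torus.partialDeriv i (Torus.partialDeriv j (u s)) x‖ ≤ M ∧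
        |Torus.partialDeriv i (Torus.partialDeriv j (θ s)) x| ≤ M ∧
        |Torus.partialDeriv i (Torus.partialDeriv j (Torus.partialDeriv k (ρ s))) x| ≤ M ∧
        ‖Torus.partialDeriv i (Torus.partialDeriv j (Torus.partialDeriv k (u s))) x‖ ≤ M ∧
        |Torus.partialDeriv i (Torus.partialDeriv j (Torus.partialDeriv k (θ s))) x| ≤ M) →
      TendstoHydroFieldsAt (fun N => localGibbsLaw σ a₀ u₀ θ₀ N (Φ N)) Φ ρ u θ t

/-- `RHL → RestartPrinciple` (landed restart induction, p108006; `S` discarded). -/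
theorem rp_of_rhl : RHL → RestartPrinciple :=
  fun h => Theorems.RestartPrinciple.restartPrinciple_of_restartableHL h

/-- `conjunct → RHL` (disprover, p103746). -/
theorem rhl_of_conjunct : _root_.HydrodynamicLimit → RHL :=
  fun h => Theorems.RestartPrincipleNegative.guardedConjunct_imp_stubRestartableHL h

/-- `RHL → conjunct` (restart induction + `stub_finiteSize`, p108006/p96553). -/
theorem conjunct_of_rhl : RHL → _root_.HydrodynamicLimit :=
  fun h => Theorems.RestartPrinciple.guardedConjunct_of_restartableHL h

/-- STRENGTHEN verdict: the rigid (inductable) form of the short-time limit is the conjunct itself. -/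
theorem rhl_iff_conjunct : RHL ↔ _root_.HydrodynamicLimit :=
  ⟨conjunct_of_rhl, rhl_of_conjunct⟩

/-! ## §4 Decomposition -/

/-- The only typed split that CONSUMES `S`: `Upgrade := S → RHL` (lift the anchored, `M`-first
short-time limit to restartable currency), then the landed induction. -/
def Upgrade : Prop := S → RHL

/-- The split is valid … -/
theorem rp_of_upgrade : Upgrade → RestartPrinciple :=
  fun h hS => conjunct_of_rhl (h hS)

/-- … and its open piece is the crux again (DECOMPOSITION verdict: `Upgrade ↔ RestartPrinciple`). -/
theorem upgrade_iff_rp : Upgrade ↔ RestartPrinciple :=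
  ⟨rp_of_upgrade, fun h hS => rhl_of_conjunct (h hS)⟩

/-- **Time-layer split, abstract schema** (the one decomposition in which an `S`-shaped hypothesis is
load-bearing). `L σ t` = "the LLN holds at time `t` at reduced density `σ`", `size σ t` = the guard
level of the classical solution on `[0,t]`. Hypotheses: `hS` = the `S`-shape (for each `M`, a step
`τ₁` and a threshold `σ₀(M)`, anchored at time `0`); `hLate` = LATE LAYER: restartable propagation
from every STRICTLY POSITIVE time with the conjunct's prefix (`σ₀` first); `h0size`/`hgrow` = the
initial guard level is bounded and does not jump instantly, uniformly in small `σ` (true for classical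
solutions from a fixed profile). Conclusion: the conjunct's shape. So FORMALLY `S` pays for the
initial layer `[0, τ₁(M₀))` and `Late` for everything else; `STRATEGY-CENSUS.md §Decomposition`
explains why `Late` (hydrodynamics from propagated, non-Gibbs data at positive times, uniformly in
the size) is the whole conjunct by time-translation covariance of the dynamics — it is line `Sketch`'s
`stub_restartableS ∧ stub_forgetting` minus the instance `s₀ = 0`. -/
theorem timeLayer_schema (L : ℝ → ℝ → Prop) (size : ℝ → ℝ → ℝ) (M₀ : ℝ) (hM₀ : 0 < M₀)
    (hS : ∀ M : ℝ, 0 < M → ∃ τ₁ : ℝ, 0 < τ₁ ∧ ∃ σ₀ : ℝ, 0 < σ₀ ∧ ∀ σ : ℝ, 0 < σ → σ < σ₀ →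
      L σ 0 → ∀ t : ℝ, 0 ≤ t → t < τ₁ → (∀ s, 0 ≤ s → s ≤ t → size σ s ≤ M) → L σ t)
    (hLate : ∃ σ₀ : ℝ, 0 < σ₀ ∧ ∀ σ : ℝ, 0 < σ → σ < σ₀ → ∀ s₀ : ℝ, 0 < s₀ →
      (∀ s, 0 ≤ s → s ≤ s₀ → L σ s) → ∀ t : ℝ, s₀ ≤ t → L σ t)
    (hgrow : ∃ δ : ℝ, 0 < δ ∧ ∀ σ : ℝ, 0 < σ → ∀ s : ℝ, 0 ≤ s → s < δ → size σ s ≤ 2 * M₀) :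
    ∃ σ₀ : ℝ, 0 < σ₀ ∧ ∀ σ : ℝ, 0 < σ → σ < σ₀ → L σ 0 → ∀ t : ℝ, 0 ≤ t → L σ t := by
  obtain ⟨τ₁, hτ₁, σ₁, hσ₁, hstep⟩ := hS (2 * M₀) (by positivity)
  obtain ⟨σ₂, hσ₂, hlate⟩ := hLate
  obtain ⟨δ, hδ, hgr⟩ := hgrow
  refine ⟨min σ₁ σ₂, lt_min hσ₁ hσ₂, fun σ hσ hσlt h0 t ht => ?_⟩
  have hσ1 : σ < σ₁ := lt_of_lt_of_le hσlt (min_le_left _ _)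
  have hσ2 : σ < σ₂ := lt_of_lt_of_le hσlt (min_le_right _ _)
  -- the first layer, paid by the `S`-shape: every `s < min τ₁ δ`
  have first : ∀ s : ℝ, 0 ≤ s → s < min τ₁ δ → L σ s := by
    intro s hs hslt
    refine hstep σ hσ hσ1 h0 s hs (lt_of_lt_of_le hslt (min_le_left _ _)) ?_
    intro s' hs' hs's
    exact hgr σ hσ s' hs' (lt_of_le_of_lt hs's (lt_of_lt_of_le hslt (min_le_right _ _)))
  set s₀ : ℝ := min τ₁ δ / 2 with hs₀def
  have hs₀pos : 0 < s₀ := by rw [hs₀def]; exact half_pos (lt_min hτ₁ hδ)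
  have hs₀lt : s₀ < min τ₁ δ := by rw [hs₀def]; exact half_lt_self (lt_min hτ₁ hδ)
  by_cases hts : t < s₀
  · exact first t ht (hts.trans hs₀lt)
  · push Not at hts
    exact hlate σ hσ hσ2 s₀ hs₀pos (fun s hs hss => first s hs (lt_of_le_of_lt hss hs₀lt)) t hts

/-- … whereas WITHOUT the late layer the `S`-shape alone entails nothing beyond its first step (time-0
anchoring; witness `L σ t := t < 1`), and even a restartable `S`-shape with `σ₀` UNDER `∀ M` does not
entail the conjunct's shape (witness `L σ t := σ * t ≤ 1`): landed as
`RestartPrincipleNegative.anchored_schema_false` / `prefixMfirst_schema_false` (p99454) — recorded here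
by name so that the census's three schema facts elaborate together. -/
example := @Theorems.RestartPrincipleNegative.anchored_schema_false
example := @Theorems.RestartPrincipleNegative.prefixMfirst_schema_false
example := @Theorems.RestartPrincipleNegative.restart_induction

end Summit.AtomisticToContinuum.HydrodynamicLimit.Cruxes.RestartPrinciple.StrategyCensus

end
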